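import Summits.CriticalPhenomena.SAWScalingLimit.Theses.SAWRenewalTightness
import Summits.CriticalPhenomena.SAWScalingLimit.Theorems.SAWRenewalTightnessEventualTightConfinementRatioMono
import Summits.CriticalPhenomena.SAWScalingLimit.Theorems.SAWRenewalTightnessConfinementPositivitySlabPairLattice
import Summits.CriticalPhenomena.SAWScalingLimit.Theorems.SAWRenewalTightnessConfinementPositivitySlabRSWOfPrimitives
import HarnessLib

/-!
# Crux `ConfinementPositivity` (stmt-CriticalPhenomena-17587), line `Sketch` (card sign-universality),
# stub `stub_slabPairReduction2`: TWO-SIDED slab tube confinement gives the crux for box pairs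

Registered side-stub `stub_slabPairReduction2` of the line: `SlabTubeConfinement' → SlabPairConfinement`,
both written out; the two-sided companion of `stub_slabPairReduction`
(`…ConfinementPositivitySlabPair.lean`, which consumes the ONE-SIDED lattice statement).

* `SlabTubeConfinement'` (hypothesis; the line's two-sided lattice statement, the conclusion of
  `slabRSW_of_kestenPrimitives`): for every aspect bound `α` there is `c > 0` such that for
  `1 ≤ W ≤ V`, `L ≤ α W`, `W ≤ α (L + 1)`, `2|y₀|, 2|y₁| ≤ W`, the partial `x_c`-mass of SAWs from
  `(0, y₀)` to `(L, y₁)` staying in the box `0 ≤ x ≤ L`, `|y| ≤ V` is at most `c⁻¹` times some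
  partial mass of those staying in `|y| ≤ W` (vertex functions `ω ∈ Zd.sawFun 2 n (L, y₁ - y₀)`).
* `SlabPairConfinement` (conclusion): the crux `SAWRenewalTightness.ConfinementPositivity` RESTRICTED
  to box pairs `D = (0,L) × (-V,V) ⊇ D' = (0,L) × (-W,W)` (`0 < W ≤ V`), marked points `a = 0`,
  `b = L`, and endpoint approximations sitting in the extremal columns of `D_δ`
  (`∀ᶠ δ, ∀ x ∈ meshVertices D δ, (a δ) 0 ≤ x 0 ≤ (b δ) 0`).

## Proof

Verbatim the proof of `stub_slabPairReduction`, with the endpoint window `ε = min (W/4) (L/4)` and the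
aspect bound `α = ⌈2L/W⌉₊ + ⌈2W/L⌉₊ + 1`.  For `δ` below the reachability / column / endpoint-window
threshold, the Jordan-nesting threshold of `D' ⊆ D` and `W/2`:

* (a) `SAW.le_law_setOf_exists_support_eq_iff` reduces the claim to `ofReal c · Z_D ≤ Z_{D'}`;
* (b) `Z_D ≤ ofReal (mass_V N)` (`SlabPair.weight_univ_le_ofReal_sum`) with `L_δ = b_δ₀ - a_δ₀`,
  `V_δ = ⌈V/δ⌉ - 1`, `y₀ = a_δ₁`, `y₁ = b_δ₁`, `N = #D_δ`;
* (c) `ofReal (mass_W N') ≤ Z_{D'}` (`SlabPair.ofReal_sum_le_weight_univ`,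
  `slabPair_exists_domainSAW_of_mem_sawFun`);
* (d) the two-sided slab statement at `α` (`1 ≤ W_δ ≤ V_δ`, `L_δ < L/δ ≤ α W_δ`, and the NEW
  bound `W_δ ≤ W/δ = (2W/L) · (L/(2δ)) ≤ α (L_δ + 1)` from `δ L_δ > L - 2ε ≥ L/2`;
  `2|y₀|, 2|y₁| ≤ W_δ` from `|δ a_δ₁|, |δ b_δ₁| < W/4`) gives
  `ofReal c · Z_D ≤ ofReal (c · mass_V N) ≤ ofReal (mass_W N') ≤ Z_{D'}`.

Finally `boxPairConfinement_of_kestenPrimitives` composes with `slabRSW_of_kestenPrimitives`: the crux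
for box pairs, conditionally on the five primitives UAT-exp, AR, S, USP, LR of Kesten's
irreducible-bridge measure.  Folklore lattice bookkeeping; no new named fact, no `def`.
-/

noncomputable section

open MeasureTheory Set Metric Filter Topology
open scoped ENNReal BigOperators Topology
open Literature.Probability.RandomPlanarGeometry Literature.Probability.RandomPlanarGeometry.SAW
open Literature.Probability.LatticeModels

namespace Summit.CriticalPhenomena.SAWScalingLimit.Theorems

open SlabPair in
/-- **Stub `stub_slabPairReduction2`** (registered signature, verbatim): `SlabTubeConfinement' →
SlabPairConfinement`, the two-sided companion of `stub_slabPairReduction`.  For the box pair with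
extremal-column endpoints, `Z_D ≤ mass_{V_δ}(N)` (every `D_δ`-walk is a slab walk: injective vertex
functions, lengths `≤ #D_δ`) and `mass_{W_δ}(N') ≤ Z_{D'}` (every slab walk of the thin box is a
`D'_δ`-walk), with `L_δ = b_δ₀ - a_δ₀`, `W_δ = ⌈W/δ⌉ - 1`, `V_δ = ⌈V/δ⌉ - 1`, `y₀ = a_δ₁`, `y₁ = b_δ₁`;
since the endpoints sit within `min (W/4) (L/4)` of the marked points, `L/(2δ) < L_δ < L/δ` and
`W/(2δ) ≤ W_δ ≤ W/δ`, so both aspect bounds hold at `α = ⌈2L/W⌉₊ + ⌈2W/L⌉₊ + 1`, and the two-sided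
slab statement gives `c Z_D ≤ Z_{D'}`, i.e. the crux event has probability `≥ c`
(`SAW.le_law_setOf_exists_support_eq_iff`). [folklore] -/
theorem stub_slabPairReduction2 : (∀ α : ℕ, 1 ≤ α → ∃ c : ℝ, 0 < c ∧ ∀ (L W V : ℕ) (y₀ y₁ : ℤ), 1 ≤ W → W ≤ V → L ≤ α * W → W ≤ α * (L + 1) → 2 * |y₀| ≤ (W : ℤ) → 2 * |y₁| ≤ (W : ℤ) → ∀ N : ℕ, ∃ N' : ℕ, c * (∑ n ∈ Finset.range (N + 1), ∑ _ω ∈ (Zd.sawFun 2 n ![(L : ℤ), y₁ - y₀]).filter (fun ω => ∀ i ≤ n, (0 : ℤ) ≤ ω i 0 ∧ ω i 0 ≤ (L : ℤ) ∧ |y₀ + ω i 1| ≤ (V : ℤ)), criticalFugacity ^ n) ≤ (∑ n ∈ Finset.range (N' + 1), ∑ _ω ∈ (Zd.sawFun 2 n ![(L : ℤ), y₁ - y₀]).filter (fun ω => ∀ i ≤ n, (0 : ℤ) ≤ ω i 0 ∧ ω i 0 ≤ (L : ℤ) ∧ |y₀ + ω i 1| ≤ (W : ℤ)), criticalFugacity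 ^ n)) → (∀ (D D' : DobrushinDomain) (a b : ℝ → Site 2) (d L V W : ℝ), 0 < L → 0 < W → W ≤ V → D.carrier = (Set.Ioo (0 : ℝ) L ×ℂ Set.Ioo (-V) V) → D'.carrier = (Set.Ioo (0 : ℝ) L ×ℂ Set.Ioo (-W) W) → D.pt 0 = 0 → D.pt 1 = (L : ℂ) → 0 < d → D'.carrier ⊆ D.carrier → D'.pt 0 = D.pt 0 → D'.pt 1 = D.pt 1 → D.carrier ∩ (Metric.ball (D.pt 0) d ∪ Metric.ball (D.pt 1) d) ⊆ D'.carrier → SAW.IsEndpointApprox D' a b → (∀ᶠ δ in 𝓝[>] (0 : ℝ), ∀ x ∈ meshVertices D.carrier δ, (a δ) 0 ≤ x 0 ∧ x 0 ≤ (b δ) 0) → ∃ c δ₀ : ℝ, 0 < c ∧ 0 < δ₀ ∧ ∀ δ ∈ Set.Ioc (0 : ℝ) δ₀, ENNReal.ofReal c ≤ SAW.law D.carrier δ (a δ) (b δ) {γ | ∃ γ' : SAW.DomainSAW D'.carrier δ (a δ) (b δ), γ'.walk.support = γ.walk.support}) := by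
  intro hS D D' a b d L V W hL hW hWV hD hD' hp0 hp1 _hd hsub h0 h1 _hsock hab hcol
  classical
  -- the slab constant at aspect `α`
  set α : ℕ := ⌈2 * L / W⌉₊ + ⌈2 * W / L⌉₊ + 1 with hα_def
  obtain ⟨c, hc, hslab⟩ := hS α (by omega)
  -- the marked points
  have hq0 : D'.pt 0 = 0 := h0.trans hp0
  have hq1 : D'.pt 1 = (L : ℂ) := h1.trans hp1
  -- eventual facts along `δ → 0⁺`
  set ε : ℝ := min (W / 4) (L / 4) with hε_def
  have hε : 0 < ε := lt_min (by positivity) (by positivity)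
  have hεW : ε ≤ W / 4 := min_le_left _ _
  have hεL4 : ε ≤ L / 4 := min_le_right _ _
  have hεL : ε ≤ L / 2 := by linarith
  have hta : ∀ᶠ δ in 𝓝[>] (0 : ℝ), dist (meshPoint δ (a δ)) 0 < ε := by
    have := hab.tendsto_fst
    rw [hq0] at this
    exact Metric.tendsto_nhds.1 this ε hε
  have htb : ∀ᶠ δ in 𝓝[>] (0 : ℝ), dist (meshPoint δ (b δ)) (L : ℂ) < ε := by
    have := hab.tendsto_snd
    rw [hq1] at this
    exact Metric.tendsto_nhds.1 this ε hε
  obtain ⟨δR, hδR, hev⟩ :=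
    (nhdsGT_basis (0 : ℝ)).eventually_iff.1 (hab.reachable.and (hcol.and (hta.and htb)))
  -- nesting of the discrete boxes
  obtain ⟨δN, hδN, hnest⟩ :=
    D'.toJordanDomain.exists_forall_meshDomain_subset D.toJordanDomain hsub
  refine ⟨c, min (δR / 2) (min δN (W / 2)), hc, lt_min (half_pos hδR) (lt_min hδN (by positivity)),
    fun δ hδ => ?_⟩
  have hδpos : 0 < δ := hδ.1
  have hδR' : δ ∈ Set.Ioo (0 : ℝ) δR :=
    ⟨hδpos, by have := hδ.2.trans (min_le_left _ _); linarith⟩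
  have hδN' : δ ≤ δN := hδ.2.trans ((min_le_right _ _).trans (min_le_left _ _))
  have hδW : δ ≤ W / 2 := hδ.2.trans ((min_le_right _ _).trans (min_le_right _ _))
  obtain ⟨hreach, hcolδ, hua, hvb⟩ := hev hδR'
  -- notation
  set u : Site 2 := a δ with hu_def
  set v : Site 2 := b δ with hv_def
  -- coordinates of the endpoints
  have hua_re : δ * (u 0 : ℝ) < ε := by
    have h := (Complex.abs_re_le_norm (meshPoint δ u)).trans_lt (by rwa [← dist_zero_right])
    rw [meshPoint_re] at h
    exact (le_abs_self _).trans_lt h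
  have hua_im : |δ * (u 1 : ℝ)| < W / 4 := by
    have h := (Complex.abs_im_le_norm (meshPoint δ u)).trans_lt (by rwa [← dist_zero_right])
    rw [meshPoint_im] at h
    exact h.trans_le hεW
  have hvb_re : L - ε < δ * (v 0 : ℝ) := by
    have h := (Complex.abs_re_le_norm (meshPoint δ v - L)).trans_lt (by rwa [← dist_eq_norm])
    rw [Complex.sub_re, meshPoint_re, Complex.ofReal_re] at h
    have := neg_abs_le (δ * (v 0 : ℝ) - L)
    linarith
  have hvb_im : |δ * (v 1 : ℝ)| < W / 4 := by
    have h := (Complex.abs_im_le_norm (meshPoint δ v - L)).trans_lt (by rwa [← dist_eq_norm])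
    rw [Complex.sub_im, meshPoint_im, Complex.ofReal_im, sub_zero] at h
    exact h.trans_le hεW
  have huv : u ≠ v := by
    intro h
    have : δ * (u 0 : ℝ) < δ * (v 0 : ℝ) := by linarith
    rw [h] at this
    exact lt_irrefl _ this
  -- the endpoints are vertices of the discrete boxes
  have huD' : u ∈ meshDomain D'.carrier δ := ConfinementAudit.mem_meshDomain_of_reachable hreach huv
  have hvD' : v ∈ meshDomain D'.carrier δ := by
    obtain ⟨p⟩ := hreach
    exact support_subset_meshDomain p huD' v p.end_mem_support
  have huD : u ∈ meshDomain D.carrier δ := hnest δ hδpos hδN' huD'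
  have huV' : u ∈ meshVertices D'.carrier δ := meshDomain_subset_meshVertices _ _ huD'
  have hvV' : v ∈ meshVertices D'.carrier δ := meshDomain_subset_meshVertices _ _ hvD'
  have huV : u ∈ meshVertices D.carrier δ := meshDomain_subset_meshVertices _ _ huD
  rw [hD', mem_meshVertices_box] at huV' hvV'
  -- nesting of the walks, `0 < Z_D < ∞`, reduction to the ratio bound
  have hN : ∀ γ' : SAW.DomainSAW D'.carrier δ u v,
      ∃ γ : SAW.DomainSAW D.carrier δ u v, γ.walk.support = γ'.walk.support :=
    fun γ' => exists_domainSAW_of_meshDomain_subset hsub (hnest δ hδpos hδN') γ'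
  have hrD : (discreteDomainGraph D.carrier δ).Reachable u v := by
    obtain ⟨p⟩ := hreach
    obtain ⟨γ, -⟩ := hN ⟨p.bypass, p.bypass_isPath⟩
    exact γ.walk.reachable
  have hZ0 : SAW.weight D.carrier δ u v Set.univ ≠ 0 := ConfinementAudit.weight_univ_ne_zero hrD
  have hZtop : SAW.weight D.carrier δ u v Set.univ ≠ ⊤ :=
    ConfinementAudit.weight_univ_ne_top D.isBounded hδpos
  refine (SAW.le_law_setOf_exists_support_eq_iff hN hZ0 hZtop _).2 ?_
  -- lattice parameters
  have hcolu := hcolδ u huV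
  set Lδ : ℕ := (v 0 - u 0).toNat with hLδ_def
  have hLδ : (Lδ : ℤ) = v 0 - u 0 := Int.toNat_of_nonneg (sub_nonneg.2 hcolu.2)
  set Wδ : ℕ := (⌈W / δ⌉ - 1).toNat with hWδ_def
  have hWδ : (Wδ : ℤ) = ⌈W / δ⌉ - 1 :=
    Int.toNat_of_nonneg (by have := Int.one_le_ceil_iff.2 (div_pos hW hδpos); omega)
  set Vδ : ℕ := (⌈V / δ⌉ - 1).toNat with hVδ_def
  have hVδ : (Vδ : ℤ) = ⌈V / δ⌉ - 1 :=
    Int.toNat_of_nonneg (by have := Int.one_le_ceil_iff.2 (div_pos (hW.trans_le hWV) hδpos); omega)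
  set y₀ : ℤ := u 1 with hy₀_def
  set y₁ : ℤ := v 1 with hy₁_def
  have htarget : v - u = ![(Lδ : ℤ), y₁ - y₀] := by
    funext i
    fin_cases i
    · simp [hLδ]
    · simp [hy₀_def, hy₁_def]
  -- real-number sizes
  have hWδR : (Wδ : ℝ) = (⌈W / δ⌉ : ℝ) - 1 := by
    have : ((Wδ : ℤ) : ℝ) = ((⌈W / δ⌉ - 1 : ℤ) : ℝ) := by rw [hWδ]
    push_cast at this
    exact this
  have hWδ_ge : W / (2 * δ) ≤ (Wδ : ℝ) := by
    rw [hWδR]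
    have h1 : W / δ ≤ (⌈W / δ⌉ : ℝ) := Int.le_ceil _
    have h2 : W / (2 * δ) = W / δ - W / (2 * δ) := by field_simp; ring
    have h3 : 1 ≤ W / (2 * δ) := by rw [le_div_iff₀ (by positivity)]; linarith
    linarith
  have hWδ_le : (Wδ : ℝ) ≤ W / δ := by
    rw [hWδR]
    linarith [Int.ceil_lt_add_one (W / δ)]
  have hW1 : 1 ≤ Wδ := by
    have h3 : 1 ≤ W / (2 * δ) := by rw [le_div_iff₀ (by positivity)]; linarith
    exact_mod_cast h3.trans hWδ_ge
  have hWV' : Wδ ≤ Vδ := by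
    have : (Wδ : ℤ) ≤ Vδ := by
      rw [hWδ, hVδ]
      have := Int.ceil_mono (div_le_div_of_nonneg_right hWV hδpos.le)
      omega
    exact_mod_cast this
  have hLδR' : (Lδ : ℝ) * δ = δ * (v 0 : ℝ) - δ * (u 0 : ℝ) := by
    have h1 : ((Lδ : ℤ) : ℝ) = ((v 0 - u 0 : ℤ) : ℝ) := by rw [hLδ]
    push_cast at h1
    rw [h1]; ring
  have hLδR : (Lδ : ℝ) < L / δ := by
    rw [lt_div_iff₀ hδpos, hLδR']
    linarith [huV'.1.1, hvV'.1.2]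
  have hLδ_gt : L / (2 * δ) < (Lδ : ℝ) := by
    rw [div_lt_iff₀ (by positivity)]
    have : (Lδ : ℝ) * (2 * δ) = 2 * (δ * (v 0 : ℝ) - δ * (u 0 : ℝ)) := by rw [← hLδR']; ring
    rw [this]
    linarith
  have hLα : Lδ ≤ α * Wδ := by
    have hαR : 2 * L / W ≤ (α : ℝ) := by
      rw [hα_def]
      push_cast
      linarith [Nat.le_ceil (2 * L / W), (Nat.cast_nonneg ⌈2 * W / L⌉₊ : (0 : ℝ) ≤ _)]
    have key : L / δ ≤ (α : ℝ) * Wδ := by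
      calc L / δ = (2 * L / W) * (W / (2 * δ)) := by field_simp
        _ ≤ (α : ℝ) * Wδ := mul_le_mul hαR hWδ_ge (by positivity) (by positivity)
    exact_mod_cast (hLδR.trans_le key).le
  have hWα : Wδ ≤ α * (Lδ + 1) := by
    have hαR : 2 * W / L ≤ (α : ℝ) := by
      rw [hα_def]
      push_cast
      linarith [Nat.le_ceil (2 * W / L), (Nat.cast_nonneg ⌈2 * L / W⌉₊ : (0 : ℝ) ≤ _)]
    have key : W / δ ≤ (α : ℝ) * ((Lδ : ℝ) + 1) := by
      calc W / δ = (2 * W / L) * (L / (2 * δ)) := by field_simp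
        _ ≤ (α : ℝ) * ((Lδ : ℝ) + 1) :=
          mul_le_mul hαR (by linarith) (by positivity) (by positivity)
    have h : (Wδ : ℝ) ≤ (α : ℝ) * ((Lδ : ℝ) + 1) := hWδ_le.trans key
    exact_mod_cast h
  have hy0 : 2 * |y₀| ≤ (Wδ : ℤ) := by
    have h1 : |(u 1 : ℝ)| < W / (4 * δ) := by
      rw [abs_mul, abs_of_pos hδpos] at hua_im
      rw [lt_div_iff₀ (by positivity)]
      nlinarith
    have h2 : 2 * |(u 1 : ℝ)| ≤ (Wδ : ℝ) := by
      have : 2 * (W / (4 * δ)) = W / (2 * δ) := by field_simp; ring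
      linarith
    have h3 : ((2 * |y₀| : ℤ) : ℝ) ≤ ((Wδ : ℤ) : ℝ) := by push_cast; exact h2
    exact_mod_cast h3
  have hy1 : 2 * |y₁| ≤ (Wδ : ℤ) := by
    have h1 : |(v 1 : ℝ)| < W / (4 * δ) := by
      rw [abs_mul, abs_of_pos hδpos] at hvb_im
      rw [lt_div_iff₀ (by positivity)]
      nlinarith
    have h2 : 2 * |(v 1 : ℝ)| ≤ (Wδ : ℝ) := by
      have : 2 * (W / (4 * δ)) = W / (2 * δ) := by field_simp; ring
      linarith
    have h3 : ((2 * |y₁| : ℤ) : ℝ) ≤ ((Wδ : ℤ) : ℝ) := by push_cast; exact h2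
    exact_mod_cast h3
  -- (b) `Z_D ≤ mass_{Vδ}(N)`
  have hfin := meshDomain_finite D.isBounded hδpos
  set N : ℕ := hfin.toFinset.card with hN_def
  have huF : u ∈ meshDomainFinset D.carrier δ := by
    rw [← Finset.mem_coe, coe_meshDomainFinset D.isBounded hδpos]; exact huD
  have huF' : u ∈ meshDomainFinset D'.carrier δ := by
    rw [← Finset.mem_coe, coe_meshDomainFinset D'.isBounded hδpos]; exact huD'
  have hb : SAW.weight D.carrier δ u v Set.univ ≤
      ENNReal.ofReal (∑ n ∈ Finset.range (N + 1),
        ∑ _ω ∈ (Zd.sawFun 2 n ![(Lδ : ℤ), y₁ - y₀]).filter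
          (fun ω => ∀ i ≤ n, (0 : ℤ) ≤ ω i 0 ∧ ω i 0 ≤ (Lδ : ℤ) ∧ |y₀ + ω i 1| ≤ (Vδ : ℤ)),
          criticalFugacity ^ n) := by
    refine weight_univ_le_ofReal_sum huF N
      (fun n => (Zd.sawFun 2 n ![(Lδ : ℤ), y₁ - y₀]).filter
        (fun ω => ∀ i ≤ n, (0 : ℤ) ≤ ω i 0 ∧ ω i 0 ≤ (Lδ : ℤ) ∧ |y₀ + ω i 1| ≤ (Vδ : ℤ)))
      (fun γ => ?_) (fun γ => ?_)
    · have := length_le_card γ huD hfin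
      omega
    · rw [Finset.mem_filter, ← htarget]
      refine ⟨vertexFn_mem_sawFun γ, fun i hi => ?_⟩
      simp only [min_eq_left hi]
      generalize hxg : γ.walk.getVert i = x
      have hxD : x ∈ meshDomain D.carrier δ := hxg ▸ getVert_mem_meshDomain γ.walk huD i
      have hx : x ∈ meshVertices D.carrier δ := meshDomain_subset_meshVertices _ _ hxD
      have hcx := hcolδ _ hx
      rw [hD, mem_meshVertices_box] at hx
      simp only [Pi.sub_apply]
      refine ⟨sub_nonneg.2 hcx.1, by rw [hLδ]; linarith [hcx.2], ?_⟩
      rw [hy₀_def, add_sub_cancel, hVδ]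
      exact abs_le_ceil_sub_one hδpos (abs_lt.2 ⟨by linarith [hx.2.1], hx.2.2⟩)
  -- (c) `mass_{Wδ}(N') ≤ Z_{D'}`
  have hcW : ∀ N' : ℕ, ENNReal.ofReal (∑ n ∈ Finset.range (N' + 1),
      ∑ _ω ∈ (Zd.sawFun 2 n ![(Lδ : ℤ), y₁ - y₀]).filter
        (fun ω => ∀ i ≤ n, (0 : ℤ) ≤ ω i 0 ∧ ω i 0 ≤ (Lδ : ℤ) ∧ |y₀ + ω i 1| ≤ (Wδ : ℤ)),
        criticalFugacity ^ n) ≤ SAW.weight D'.carrier δ u v Set.univ := by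
    intro N'
    refine ofReal_sum_le_weight_univ huF' N'
      (fun n => (Zd.sawFun 2 n ![(Lδ : ℤ), y₁ - y₀]).filter
        (fun ω => ∀ i ≤ n, (0 : ℤ) ≤ ω i 0 ∧ ω i 0 ≤ (Lδ : ℤ) ∧ |y₀ + ω i 1| ≤ (Wδ : ℤ)))
      fun n ω hω => ?_
    rw [Finset.mem_filter, ← htarget] at hω
    obtain ⟨hω, hbox⟩ := hω
    have hconv : Convex ℝ D'.carrier := by rw [hD']; exact convex_box L W
    refine slabPair_exists_domainSAW_of_mem_sawFun hconv huD' hω fun i hi => ?_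
    obtain ⟨h0i, hLi, hWi⟩ := hbox i hi
    rw [hD', mem_meshVertices_box]
    simp only [Pi.add_apply, Int.cast_add]
    have hLi' : (ω i 0 : ℝ) ≤ (v 0 : ℝ) - (u 0 : ℝ) := by
      have : ((ω i 0 : ℤ) : ℝ) ≤ ((Lδ : ℤ) : ℝ) := by exact_mod_cast hLi
      rw [hLδ] at this; push_cast at this; exact this
    have h0i' : (0 : ℝ) ≤ (ω i 0 : ℝ) := by exact_mod_cast h0i
    have hm0 : 0 ≤ δ * (ω i 0 : ℝ) := mul_nonneg hδpos.le h0i'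
    have hm1 : δ * (ω i 0 : ℝ) ≤ δ * (v 0 : ℝ) - δ * (u 0 : ℝ) := by
      rw [← mul_sub]; exact mul_le_mul_of_nonneg_left hLi' hδpos.le
    have hWi' : |u 1 + ω i 1| ≤ ⌈W / δ⌉ - 1 := by rw [← hWδ]; exact hWi
    have habs := abs_mul_lt_of_abs_le hδpos hWi'
    push_cast at habs
    obtain ⟨habs1, habs2⟩ := abs_lt.1 habs
    refine ⟨⟨?_, ?_⟩, ?_, ?_⟩
    · rw [mul_add]; linarith [huV'.1.1]
    · rw [mul_add]; linarith [hvV'.1.2]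
    · linarith
    · linarith
  -- (d) the two-sided slab statement
  obtain ⟨N', hN'⟩ := hslab Lδ Wδ Vδ y₀ y₁ hW1 hWV' hLα hWα hy0 hy1 N
  calc ENNReal.ofReal c * SAW.weight D.carrier δ u v Set.univ
      ≤ ENNReal.ofReal c * ENNReal.ofReal (∑ n ∈ Finset.range (N + 1),
          ∑ _ω ∈ (Zd.sawFun 2 n ![(Lδ : ℤ), y₁ - y₀]).filter
            (fun ω => ∀ i ≤ n, (0 : ℤ) ≤ ω i 0 ∧ ω i 0 ≤ (Lδ : ℤ) ∧ |y₀ + ω i 1| ≤ (Vδ : ℤ)),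
            criticalFugacity ^ n) := mul_le_mul_right hb _
    _ = ENNReal.ofReal (c * ∑ n ∈ Finset.range (N + 1),
          ∑ _ω ∈ (Zd.sawFun 2 n ![(Lδ : ℤ), y₁ - y₀]).filter
            (fun ω => ∀ i ≤ n, (0 : ℤ) ≤ ω i 0 ∧ ω i 0 ≤ (Lδ : ℤ) ∧ |y₀ + ω i 1| ≤ (Vδ : ℤ)),
            criticalFugacity ^ n) := (ENNReal.ofReal_mul hc.le).symm
    _ ≤ ENNReal.ofReal (∑ n ∈ Finset.range (N' + 1),
          ∑ _ω ∈ (Zd.sawFun 2 n ![(Lδ : ℤ), y₁ - y₀]).filter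
            (fun ω => ∀ i ≤ n, (0 : ℤ) ≤ ω i 0 ∧ ω i 0 ≤ (Lδ : ℤ) ∧ |y₀ + ω i 1| ≤ (Wδ : ℤ)),
            criticalFugacity ^ n) := ENNReal.ofReal_le_ofReal hN'
    _ ≤ SAW.weight D'.carrier δ u v Set.univ := hcW N'

/-- **The SAW box-crossing property for rectangles, conditionally**: restriction positivity
`ConfinementPositivity` for the box pairs `(0,L)×(-V,V) ⊇ (0,L)×(-W,W)` with extremal-column endpoint
approximations, modulo the five primitives UAT-exp, AR, S, USP, LR of Kesten's irreducible-bridge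
measure (all OPEN) — the composite of `slabRSW_of_kestenPrimitives` (p165405) and
`stub_slabPairReduction2`; the line's one conditional special case of the crux stated on the crux's own
objects. [folklore] -/
theorem boxPairConfinement_of_kestenPrimitives :
    ((∃ C : ℝ, 0 < C ∧ ∀ s t : ℕ, 1 ≤ s → 1 ≤ t →
      (∑' w : {w : List Step // IsIrrBridge w},
          {w : {w : List Step // IsIrrBridge w} | xEnd w.1 = s ∧
              t * s ≤ (Finset.range (w.1.length + 1)).sup fun i => (traj w.1 i 1).natAbs}.indicator
            (fun w => criticalFugacity ^ w.1.length) w) ≤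
        C * Real.exp (-(t : ℝ) / C) * ∑' w : {w : List Step // IsIrrBridge w},
          {w : {w : List Step // IsIrrBridge w} | xEnd w.1 = s}.indicator
            (fun w => criticalFugacity ^ w.1.length) w) ∧
    (∃ C : ℝ, 0 < C ∧ ∀ s : ℕ, 1 ≤ s → ∀ h : ℤ,
      (∑' w : {w : List Step // IsIrrBridge w},
          {w : {w : List Step // IsIrrBridge w} | xEnd w.1 = s ∧ wEnd w.1 1 = h}.indicator
            (fun w => criticalFugacity ^ w.1.length) w) ≤
        C / s * ∑' w : {w : List Step // IsIrrBridge w},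
          {w : {w : List Step // IsIrrBridge w} | xEnd w.1 = s}.indicator
            (fun w => criticalFugacity ^ w.1.length) w)) →
    ((∀ a b : ℕ, 1 ≤ a → 1 ≤ b → ∃ q : ℝ, 0 < q ∧ ∀ W L : ℕ, b ≤ W → L ≤ a * W →
      ENNReal.ofReal q *
          (∑' l : {l : List (List Step) // (∀ w ∈ l, IsIrrBridge w) ∧ (l.map xEnd).sum = (L : ℤ) ∧ True},
            ENNReal.ofReal (criticalFugacity ^ (l.1.map List.length).sum)) ≤
        ∑' l : {l : List (List Step) // (∀ w ∈ l, IsIrrBridge w) ∧ (l.map xEnd).sum = (L : ℤ) ∧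
            ∀ w ∈ l, (b : ℤ) * xEnd w ≤ (W : ℤ)},
          ENNReal.ofReal (criticalFugacity ^ (l.1.map List.length).sum)) ∧
    (∃ C : ℝ, 0 < C ∧ ∀ K n : ℕ, 1 ≤ K →
      (K : ℝ≥0∞) ^ 2 *
          (∑' l : {l : List (List Step) // (∀ w ∈ l, IsIrrBridge w) ∧ (l.map xEnd).sum = (n : ℤ) ∧
              ∀ w ∈ l, (K : ℤ) * xEnd w < (n : ℤ)},
            ENNReal.ofReal (criticalFugacity ^ (l.1.map List.length).sum)) ≤
        ENNReal.ofReal C *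
          ∑' l : {l : List (List Step) // (∀ w ∈ l, IsIrrBridge w) ∧ (l.map xEnd).sum = (n : ℤ) ∧ True},
            ENNReal.ofReal (criticalFugacity ^ (l.1.map List.length).sum)) ∧
    (∀ A D : ℕ, 1 ≤ A → 1 ≤ D → ∃ s₀ : ℕ, ∃ c : ℝ, 0 < c ∧ ∀ s : ℕ, s₀ ≤ s → ∀ h : ℤ, |h| ≤ ((A * s : ℕ) : ℤ) →
      c / s * (∑' w : {w : List Step // IsIrrBridge w},
          {w : {w : List Step // IsIrrBridge w} | xEnd w.1 = s}.indicator
            (fun w => criticalFugacity ^ w.1.length) w) ≤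
        ∑' w : {w : List Step // IsIrrBridge w},
          {w : {w : List Step // IsIrrBridge w} | xEnd w.1 = s ∧ wEnd w.1 1 = h ∧
              ∀ i, (D : ℤ) * min h 0 - (s : ℤ) ≤ (D : ℤ) * traj w.1 i 1 ∧
                (D : ℤ) * traj w.1 i 1 ≤ (D : ℤ) * max h 0 + (s : ℤ)}.indicator
            (fun w => criticalFugacity ^ w.1.length) w)) →
    (∀ (D D' : DobrushinDomain) (a b : ℝ → Site 2) (d L V W : ℝ), 0 < L → 0 < W → W ≤ V →
      D.carrier = (Set.Ioo (0 : ℝ) L ×ℂ Set.Ioo (-V) V) →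
      D'.carrier = (Set.Ioo (0 : ℝ) L ×ℂ Set.Ioo (-W) W) → D.pt 0 = 0 → D.pt 1 = (L : ℂ) →
      0 < d → D'.carrier ⊆ D.carrier → D'.pt 0 = D.pt 0 → D'.pt 1 = D.pt 1 →
      D.carrier ∩ (Metric.ball (D.pt 0) d ∪ Metric.ball (D.pt 1) d) ⊆ D'.carrier →
      SAW.IsEndpointApprox D' a b →
      (∀ᶠ δ in 𝓝[>] (0 : ℝ), ∀ x ∈ meshVertices D.carrier δ, (a δ) 0 ≤ x 0 ∧ x 0 ≤ (b δ) 0) →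
      ∃ c δ₀ : ℝ, 0 < c ∧ 0 < δ₀ ∧ ∀ δ ∈ Set.Ioc (0 : ℝ) δ₀,
        ENNReal.ofReal c ≤ SAW.law D.carrier δ (a δ) (b δ)
          {γ | ∃ γ' : SAW.DomainSAW D'.carrier δ (a δ) (b δ),
            γ'.walk.support = γ.walk.support}) :=
  fun hP hR => stub_slabPairReduction2 (slabRSW_of_kestenPrimitives hP hR)

end Summit.CriticalPhenomena.SAWScalingLimit.Theorems

end
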